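import Summits.QuantumFields.YangMills.Theorems.BalabanUVNodesN07SchemeTokensOfRecord
import HarnessLib

/-!
# NODE N07 — [B9] (3.134) «the second quadratic form in (3.128) DEFINES `Δ⁽²⁾`»: A `Δ2` WITH def-Y's TOKENS `Delta2Tok ∧ Delta2SymmTok` (✓3g′ `Node00.BgSchemeOfRecord`) EXISTS
# at every displayed background — finite-dimensional linear algebra: every bilinear form on the space (115) of record is the (27)-pairing of an `L²` bond operator read as a current

Cell `pub-ymgap`, width seat `pub-ymgap-dag-n07-w3` (g25), INTENT-11 ∕ CLAIM-11.  `--kind proof --supports stmt-QuantumFields-27238 --as helper`; count-neutral.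
[15] = [Balaban1985Variational]; [B9] = [Balaban1985BackgroundPropagators].

WHAT.  3g′ reads [B9] (3.134) `⟨A, Δ⁽²⁾A⟩ := −2⟨HC⁽²⁾(A), J⟩` as the token `Delta2Tok levB a hpos♭ hQ Δ2` on a DATUM `Δ2` (an `L²` bond operator read as a current through lit
`currentCLM`, paired by (27)), with its symmetry `Delta2SymmTok Δ2`, and lists «the EXISTENCE of a `Δ2` with `Delta2Tok` (linear algebra over the transpose pairing; a support
statement)» as not done.  This file proves it, in three steps:
* §1 `exists_tpair_repr` — on the record's `L²` bond space every bilinear form `β` is `(u, v) ↦ (T u, v)_τ` for the BILINEAR trace pairing `tpair φ τ` and some linear `T`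
  (Riesz through `tpair f g = ⟪f⋆, g⟫`, lit ✓`tpair_eq_inner_starW`, and the conjugate-linear `⋆` of lit `starW`);
* §2 `pair27_currentCLM_eq_tpair` (the (27)-pairing of a read current IS `(η^d/c₀)·tpair` on the `L²` side, lit ✓`sum_trace_currentCLM`), ★★ `exists_currentOfRecord_pair27_eq` —
  EVERY continuous bilinear form `B` on `Space115Lit` is `(Y, Z) ↦ ⟨T̂Y, Z⟩₍₂₇₎` for some `L²` operator `T`;
* §3 ★★★ `exists_delta2Tok_and_delta2SymmTok` — with `B(Y,Z) := −⟨H♭·D²C^{𝔰𝔩}(0)(Y,Z), J⟩₍₂₇₎` symmetrized (`quadPart C A = ½D²C(0)(A,A)`, Mathlib `iteratedFDeriv_two_apply`):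
  `∃ Δ2, Delta2Tok levB a hpos♭ hQ Δ2 ∧ Delta2SymmTok Δ2` — for ALL displayed data (`levB`, `a`, `hpos♭`, `hQ`), at every background.

HONEST LABELS.  Existence by finite-dimensional representability; NO formula for `Δ⁽²⁾` beyond its defining form, NO bound (`‖Δ⁽²⁾‖`, [B9] (3.136)–(3.138)), NO reality
(`HessSymmTok Δ2` for THIS `Δ2` is NOT claimed — it is the reality of `C^{𝔰𝔩}`, `H♭`, `J`, a separate statement), no uniqueness asserted.  Count-neutral; N07 NOT discharged;
P0 ⟨26900⟩ OPEN; R4 is the conditional finite-𝕋⁴ rung only.  Nothing here is a claim about the Yang–Mills mass gap (`Summit.QuantumFields`): finite torus, fixed `ε`; nothing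
continuum ∕ OS ∕ Clay.
-/

set_option autoImplicit false

noncomputable section

open scoped Matrix Matrix.Norms.L2Operator InnerProductSpace ComplexConjugate BigOperators

namespace Summit.QuantumFields.YangMills.Theorems.N07Delta2OfRecordExists

open Literature.MathematicalPhysics.QuantumFieldTheory.Balaban1983to89
open Literature.MathematicalPhysics.QuantumFieldTheory.Balaban1983to89.T4Continuum (T4Family)
open T4Continuum BlockAveraging
open B9SectCLatticeCarrier (Bond)
open B9Eq311L2Pairing (WL2)
open B9Eq311TracePairing (tpair starW starW_starW starW_add starW_smul tpair_eq_inner_starW)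
open B11Eq111FrakG (nabla115 jetLinearEquiv)
open B11Eq103H1Complex (BondL2K funEquiv funEquiv_apply funEquiv_symm_apply)
open B11Eq115Space (NegSup NegSize levWeight JetSup)
open B11Eq90V0primeCurrent (flat115 flat115_apply)
open B11Eq90Transpose (pair27 pair27_eq_sum pair27_smul_right)
open B11Eq80Current (quadPart pairL pairL_apply)
open B9Eq3119DeltaPiCarrier (currentCLM sum_trace_currentCLM)
open Node00
open Summit.QuantumFields.YangMills.Theorems.N07HessOpOfRecordSymmetric (tauRec_mul_comm)

variable (F : T4Family) (N : ℕ) (K : ℕ) (k : ℕ) (Ω : ℕ → Set (Site (F.P K) 0)) (U₀ : GaugeField (F.P K) 0 (SU N))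

/-! ## §1  Representability through the bilinear trace pairing on the record's `L²` bond space -/

/-- ★ **EVERY BILINEAR FORM ON THE RECORD'S `L²` BOND SPACE IS `(u, v) ↦ (T u, v)_τ`** for the bilinear trace pairing `(f, g)_τ = Σ_b c₀ tr(f(b)g(b))` and some linear `T`
(`(f, g)_τ = ⟪f⋆, g⟫`, Riesz, `⋆` conjugate-linear). [cite: Balaban1985BackgroundPropagators, (3.11) p.392, (3.134) p.422] -/
theorem exists_tpair_repr [Fact (0 < c0Rec F K k)]
    (β : BondL2K ℂ (F.P K).d (fun _ => (F.P K).sitesPerDir 0) (c0Rec F K k) (WRec N) →ₗ[ℂ]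
      BondL2K ℂ (F.P K).d (fun _ => (F.P K).sitesPerDir 0) (c0Rec F K k) (WRec N) →ₗ[ℂ] ℂ) :
    ∃ T : BondL2K ℂ (F.P K).d (fun _ => (F.P K).sitesPerDir 0) (c0Rec F K k) (WRec N) →ₗ[ℂ]
        BondL2K ℂ (F.P K).d (fun _ => (F.P K).sitesPerDir 0) (c0Rec F K k) (WRec N),
      ∀ u v, tpair (phiRec N) (tauRec N) (T u) v = β u v := by
  refine ⟨{ toFun := fun u => starW (phiRec N)
              ((InnerProductSpace.toDual ℂ (BondL2K ℂ (F.P K).d (fun _ => (F.P K).sitesPerDir 0) (c0Rec F K k) (WRec N))).symm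
                (LinearMap.toContinuousLinearMap (β u)))
            map_add' := fun u u' => by rw [map_add, map_add, map_add, starW_add]
            map_smul' := fun c u => by
              rw [map_smul, map_smul, LinearIsometryEquiv.map_smulₛₗ, starW_smul, RingHom.id_apply, starRingEnd_self_apply] }, fun u v => ?_⟩
  rw [LinearMap.coe_mk, AddHom.coe_mk, tpair_eq_inner_starW (phiRec N) (tauRec N) inner_phiRec_symm, starW_starW, InnerProductSpace.toDual_symm_apply,
    LinearMap.coe_toContinuousLinearMap']

/-! ## §2  The (27)-pairing of a read current is the trace pairing on the `L²` side; every bilinear form on the space (115) of record is so represented -/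

section Carrier

variable [Fact (0 < (F.L : ℝ))] [Fact (0 < (F.P K).eta k)] [Fact (0 < c0Rec F K k)]

/-- **`⟨T̂Y, Z⟩₍₂₇₎ = (η^d ∕ c₀) · (T Ŷ, Ẑ)_τ`** — the (27)-pairing of the current reading of `T` against `Z` is the bilinear trace pairing of `T Ŷ` with `Ẑ` on the `L²` side
(`Ŷ`, `Ẑ` the underlying bond functions read on the Hilbert fibre; lit ✓`pair27_eq_sum`, ✓`sum_trace_currentCLM`). [cite: Balaban1985Variational, (27) p.282; Balaban1985BackgroundPropagators, (3.11) p.392] -/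
theorem pair27_currentCLM_eq_tpair
    (T : BondL2K ℂ (F.P K).d (fun _ => (F.P K).sitesPerDir 0) (c0Rec F K k) (WRec N) →ₗ[ℂ]
      BondL2K ℂ (F.P K).d (fun _ => (F.P K).sitesPerDir 0) (c0Rec F K k) (WRec N)) (Y Z : Space115Lit F N K k Ω U₀) :
    pair27 (tauRecCLM N) (currentCLM (phiRec N) (pairLevLit F Ω k) (nabla115 ((F.P K).eta k) (unitsOfRecord F N U₀)) T Y) (flat115 Z) =
      ((((F.P K).eta k : ℝ) : ℂ)) ^ (F.P K).d * (c0Rec F K k : ℂ)⁻¹ *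
        tpair (phiRec N) (tauRec N)
          (T ((funEquiv (phiRec N) (fun _ : Bond (F.P K).d (fun _ => (F.P K).sitesPerDir 0) => c0Rec F K k)).symm (flat115 Y)))
          ((funEquiv (phiRec N) (fun _ : Bond (F.P K).d (fun _ => (F.P K).sitesPerDir 0) => c0Rec F K k)).symm (flat115 Z)) := by
  have hc₀ : (c0Rec F K k : ℂ) ≠ 0 := by exact_mod_cast (Fact.out : 0 < c0Rec F K k).ne'
  rw [pair27_eq_sum, ← sum_trace_currentCLM (phiRec N) (tauRec N) (pairLevLit F Ω k) (nabla115 ((F.P K).eta k) (unitsOfRecord F N U₀)) T Y (flat115 Z),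
    mul_assoc, inv_mul_cancel_left₀ hc₀]
  rfl

/-- ★★ **EVERY CONTINUOUS BILINEAR FORM `B` ON THE SPACE (115) OF RECORD IS `(Y, Z) ↦ ⟨T̂Y, Z⟩₍₂₇₎` FOR SOME `L²` BOND OPERATOR `T`** (read as a current through lit `currentCLM`): §1
applied to `(c₀ ∕ η^d)·B` transported to the `L²` side along the linear bijection `Y ↦ Ŷ`. [cite: Balaban1985Variational, (27) p.282, (115) p.294; Balaban1985BackgroundPropagators, (3.134) p.422] -/
theorem exists_currentOfRecord_pair27_eq (B : Space115Lit F N K k Ω U₀ →L[ℂ] Space115Lit F N K k Ω U₀ →L[ℂ] ℂ) :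
    ∃ T : BondL2K ℂ (F.P K).d (fun _ => (F.P K).sitesPerDir 0) (c0Rec F K k) (WRec N) →ₗ[ℂ]
        BondL2K ℂ (F.P K).d (fun _ => (F.P K).sitesPerDir 0) (c0Rec F K k) (WRec N),
      ∀ Y Z : Space115Lit F N K k Ω U₀,
        pair27 (tauRecCLM N) (currentCLM (phiRec N) (pairLevLit F Ω k) (nabla115 ((F.P K).eta k) (unitsOfRecord F N U₀)) T Y) (flat115 Z) = B Y Z := by
  have hc₀ : (c0Rec F K k : ℂ) ≠ 0 := by exact_mod_cast (Fact.out : 0 < c0Rec F K k).ne'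
  have hη : ((((F.P K).eta k : ℝ) : ℂ)) ^ (F.P K).d ≠ 0 := pow_ne_zero _ (by exact_mod_cast (Fact.out : 0 < (F.P K).eta k).ne')
  -- the inverse reading `u ↦ Y(u)` of `Y ↦ Ŷ`
  let E : BondL2K ℂ (F.P K).d (fun _ => (F.P K).sitesPerDir 0) (c0Rec F K k) (WRec N) →ₗ[ℂ] Space115Lit F N K k Ω U₀ :=
    (jetLinearEquiv (F.L : ℝ) ((F.P K).eta k) (bondLevLit F Ω k) (pairLevLit F Ω k) (nabla115 ((F.P K).eta k) (unitsOfRecord F N U₀))).symm.toLinearMap ∘ₗ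
      (funEquiv (phiRec N) (fun _ : Bond (F.P K).d (fun _ => (F.P K).sitesPerDir 0) => c0Rec F K k)).toLinearMap
  have hE : ∀ Y : Space115Lit F N K k Ω U₀,
      E ((funEquiv (phiRec N) (fun _ : Bond (F.P K).d (fun _ => (F.P K).sitesPerDir 0) => c0Rec F K k)).symm (flat115 Y)) = Y := fun Y => by
    simp only [E, LinearMap.comp_apply, LinearEquiv.coe_toLinearMap, LinearEquiv.apply_symm_apply]
    exact (jetLinearEquiv (F.L : ℝ) ((F.P K).eta k) (bondLevLit F Ω k) (pairLevLit F Ω k) (nabla115 ((F.P K).eta k) (unitsOfRecord F N U₀))).symm_apply_apply Y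
  -- the transported form `(c₀ / η^d) · B(Y(u), Y(v))`
  let β : BondL2K ℂ (F.P K).d (fun _ => (F.P K).sitesPerDir 0) (c0Rec F K k) (WRec N) →ₗ[ℂ]
      BondL2K ℂ (F.P K).d (fun _ => (F.P K).sitesPerDir 0) (c0Rec F K k) (WRec N) →ₗ[ℂ] ℂ :=
    LinearMap.mk₂ ℂ (fun u v => (c0Rec F K k : ℂ) * ((((((F.P K).eta k : ℝ) : ℂ)) ^ (F.P K).d)⁻¹) * B (E u) (E v))
      (fun u u' v => by rw [map_add, map_add, add_apply, mul_add])
      (fun c u v => by rw [map_smul, map_smul, smul_apply, smul_eq_mul, smul_eq_mul, mul_left_comm])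
      (fun u v v' => by rw [map_add, map_add, mul_add])
      (fun c u v => by rw [map_smul, map_smul, smul_eq_mul, smul_eq_mul, mul_left_comm])
  obtain ⟨T, hT⟩ := exists_tpair_repr F N K k β
  refine ⟨T, fun Y Z => ?_⟩
  rw [pair27_currentCLM_eq_tpair, hT, LinearMap.mk₂_apply, hE, hE, ← mul_assoc, ← mul_assoc, mul_assoc (_ ^ _), inv_mul_cancel₀ hc₀, mul_one,
    mul_inv_cancel₀ hη, one_mul]

end Carrier

/-! ## §3  [B9] (3.134): a `Δ2` with `Delta2Tok ∧ Delta2SymmTok` exists, for all displayed data -/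

section Delta2

variable [NeZero N] [Fact (0 < (F.L : ℝ))] [Fact (0 < (F.P K).eta k)] [Fact (0 < c0Rec F K k)] [Fact (∀ c, 0 < wBRec F K k c)]

omit [NeZero N] [Fact (0 < c0Rec F K k)] [Fact (∀ c, 0 < wBRec F K k c)] in
/-- `quadPart C A = ½·D²C(0)(A, A)` with Mathlib's curried second derivative (`iteratedFDeriv_two_apply`). [cite: Balaban1985Variational, (56) p.286, (78) p.290] -/
theorem quadPart_eq_fderiv_fderiv {𝒳 : Type*} [NormedAddCommGroup 𝒳] [NormedSpace ℂ 𝒳] (C : Space115Lit F N K k Ω U₀ → 𝒳) (A : Space115Lit F N K k Ω U₀) :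
    quadPart C A = (2 : ℂ)⁻¹ • fderiv ℂ (fderiv ℂ C) 0 A A := by
  rw [quadPart, iteratedFDeriv_two_apply]

/-- ★★★ **[B9] (3.134) AT THE RECORD: A SECOND-ORDER OPERATOR `Δ2` WITH def-Y's TOKENS `Delta2Tok ∧ Delta2SymmTok` EXISTS**, for every block-level datum `levB`, Landau `a`,
displayed `hpos♭`, `hQ`, at every background `U₀`: take the continuous bilinear form `B(Y, Z) := −⟨H♭(D²C^{𝔰𝔩}(0)(Y, Z)), J⟩₍₂₇₎`, symmetrize, and represent it by §2; on the
diagonal `B(A, A) = −2⟨H♭C⁽²⁾(A), J⟩₍₂₇₎` since `C⁽²⁾(A) = quadPart C^{𝔰𝔩} A = ½D²C^{𝔰𝔩}(0)(A, A)`.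
[cite: Balaban1985BackgroundPropagators, (3.134)–(3.135) p.422, (3.128) p.421; Balaban1985Variational, (78)–(79) p.290, (27) p.282] -/
theorem exists_delta2Tok_and_delta2SymmTok (levB : PBond (F.P K) k → ℕ) (a : ℝ)
    (hposb : ∀ x, x ≠ 0 → 0 < RCLike.re ⟪x, laplaceAOfRecord F N k U₀ (QOfRecord F N k U₀) (QflatOfRecord F N k) a x⟫_ℂ)
    (hQ : Function.Surjective (QOfRecord F N k U₀)) :
    ∃ Δ2 : BondL2K ℂ (F.P K).d (fun _ => (F.P K).sitesPerDir 0) (c0Rec F K k) (WRec N) →ₗ[ℂ]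
        BondL2K ℂ (F.P K).d (fun _ => (F.P K).sitesPerDir 0) (c0Rec F K k) (WRec N),
      Delta2Tok F N K k Ω U₀ levB a hposb hQ Δ2 ∧ Delta2SymmTok F N K k Ω U₀ Δ2 := by
  -- the letters: `M = D²C^{𝔰𝔩}(0)` (curried), `ℓ = ⟨H♭(·), J⟩₍₂₇₎`, `B(Y,Z) = −ℓ(M Y Z)`, `Bs` its symmetrization
  let M : Space115Lit F N K k Ω U₀ →L[ℂ] Space115Lit F N K k Ω U₀ →L[ℂ] NegSize (F.L : ℝ) ((F.P K).eta k) levB 0 (Matrix (Fin N) (Fin N) ℂ) :=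
    fderiv ℂ (fderiv ℂ (CslOfRecord F N K k Ω U₀ levB)) 0
  let ℓ : NegSize (F.L : ℝ) ((F.P K).eta k) levB 0 (Matrix (Fin N) (Fin N) ℂ) →L[ℂ] ℂ :=
    (pairL (tauRecCLM N) (JOfRecordAtBg F N K k Ω U₀)).comp (H1OfRecordAtBgFlat F N K k Ω U₀ levB a hposb hQ)
  let B : Space115Lit F N K k Ω U₀ →L[ℂ] Space115Lit F N K k Ω U₀ →L[ℂ] ℂ :=
    -((ContinuousLinearMap.compL ℂ (Space115Lit F N K k Ω U₀) (NegSize (F.L : ℝ) ((F.P K).eta k) levB 0 (Matrix (Fin N) (Fin N) ℂ)) ℂ ℓ).comp M)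
  have hB : ∀ Y Z, B Y Z = -pair27 (tauRecCLM N) (JOfRecordAtBg F N K k Ω U₀) (flat115 (H1OfRecordAtBgFlat F N K k Ω U₀ levB a hposb hQ (M Y Z))) := fun Y Z => by
    simp only [B, ℓ, neg_apply, ContinuousLinearMap.comp_apply, ContinuousLinearMap.compL_apply, pairL_apply]
  let Bs : Space115Lit F N K k Ω U₀ →L[ℂ] Space115Lit F N K k Ω U₀ →L[ℂ] ℂ := B + B.flip
  have hBs : ∀ Y Z, Bs Y Z = B Y Z + B Z Y := fun Y Z => by
    simp only [Bs, add_apply, ContinuousLinearMap.flip_apply]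
  obtain ⟨T, hT⟩ := exists_currentOfRecord_pair27_eq F N K k Ω U₀ ((2 : ℂ)⁻¹ • Bs)
  refine ⟨T, fun A => ?_, fun Y Z => ?_⟩
  · -- (3.134) on the diagonal
    rw [hT, smul_apply, smul_apply, hBs, hB, smul_eq_mul, quadPart_eq_fderiv_fderiv, map_smul, map_smul,
      pair27_smul_right]
    ring
  · -- symmetry for the pairing (27)
    rw [hT, hT, smul_apply, smul_apply, smul_apply, smul_apply, hBs, hBs,
      add_comm]

end Delta2

end Summit.QuantumFields.YangMills.Theorems.N07Delta2OfRecordExists
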